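import Summits.Ventures.PercRepro.PerFlatTransfer
import Summits.Ventures.PercRepro.SixThreeShares

/-!
# PercRepro — the per-plane inequality at `(6, 3)` for planes with `≥ 6` outside points, modulo the per-triple lemma (p2, gen 6)

The per-plane inequality of the soft max-trace rule (mine-2 `MINE2-RLS.md` §19) on a plane `G` reads
`3 · #U_G ≤ Σ_{S ∈ Y} w(G, S)`, `U_G = {B ⊆ G : ρ(B) = 3, ρ(E ∖ B) = 6}`.  The supply of `G` is at least
`Σ_{B ∈ U_G} s(B)` with `s(B) = Σ_{S ∈ Y, S ∩ G = B} w(G, S)` (distinct `B` have disjoint witness families), and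

* `|B| ≥ 4`: `s(B) ≥ 3` by Theorem P₂'s `|B| ≥ 4` step (`supply_ge_three_of_four_le`) from any `6` points outside
  `G` (a plane with `ρ(E ∖ G) ≥ 6` has them);
* `|B| = 3`: Theorem P₁ in mine-2's primal form (§19.4′: `T` a rank-`3` triple, `W` an independent `6`-set outside
  the plane, the witnesses inside `T ∪ W` supply `≥ 3`, no ambient-rank hypothesis) — taken here as `hP₁`; a plane with
  `ρ(E ∖ G) ≥ 6` has such a `W` (`exists_indep_six`).

So `perPlane_of_six_le` proves the per-plane inequality for the planes with `ρ(E ∖ G) ≥ 6` modulo P₁ (§19.5);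
`SixThreeCompose.lean` composes it with `SixThreeFrame.lean`: C-025 at `(6, 3)` on every finite matroid follows from
P₁ together with the per-plane inequality on the planes with `ρ(E ∖ G) ≤ 5` of the core matroids (mine-2's
`(I₁)`–`(I₃)`, types `t = 6 − ρ(E ∖ G) ≥ 1`, using all `|E ∖ G| ≥ 6 − t` outside points — Lemma R is not needed).
-/

namespace PercRepro

namespace SixThree

open Finset ThmH PerFlat

variable {α : Type*} [DecidableEq α] {M : Matroid α} [M.Finite]

/-- The normalised share of the plane `G` from the set `S`, as written in the frame. -/
theorem share_eq (G S : Finset α) :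
    fRule M G S / ∑ G' ∈ planes M, fRule M G' S = fRule M G S / D M S := rfl

omit [DecidableEq α] in
/-- Membership in `Yq M 6 3`: subsets of the ground set of rank `4` or `5`. -/
theorem mem_Yq_six_three {S : Finset α} :
    S ∈ Yq M 6 3 ↔ S ⊆ gr M ∧ (3 : ℕ∞) < M.eRk (S : Set α) ∧ M.eRk (S : Set α) < 6 := by
  unfold Yq
  rw [Finset.mem_filter, Finset.mem_powerset]
  rfl

/-- Membership in `UqG M 6 3 G`. -/
theorem mem_UqG_six_three {G B : Finset α} :
    B ∈ UqG M 6 3 G ↔ (B ⊆ gr M ∧ M.eRk (B : Set α) = 3 ∧ M.eRk ((gr M \ B : Finset α) : Set α) = 6) ∧ B ⊆ G := by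
  unfold UqG
  rw [Finset.mem_filter, mem_Uq]
  rfl

/-- The supply of `G` is at least the sum over `B ∈ U_G` of the supplies of the witness families `{S : S ∩ G = B}`. -/
theorem sum_UqG_le_supply (G : Finset α) :
    ∑ B ∈ UqG M 6 3 G, ∑ S ∈ (Yq M 6 3).filter (fun S => S ∩ G = B), fRule M G S / D M S ≤
      ∑ S ∈ Yq M 6 3, fRule M G S / D M S := by
  classical
  have hmaps : ∀ S ∈ Yq M 6 3, S ∩ G ∈ G.powerset := by
    intro S _
    rw [Finset.mem_powerset]
    exact Finset.inter_subset_right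
  rw [← Finset.sum_fiberwise_of_maps_to hmaps]
  apply Finset.sum_le_sum_of_subset_of_nonneg
  · intro B hB
    rw [Finset.mem_powerset]
    exact (mem_UqG_six_three.1 hB).2
  · intro B _ _
    apply Finset.sum_nonneg
    intro S _
    exact div_nonneg (fRule_nonneg M G S) (D_nonneg M S)

/-- A `6`-element independent subset of `E ∖ G` when `ρ(E ∖ G) ≥ 6`. -/
theorem exists_indep_six {G : Finset α} (hr6 : (6 : ℕ∞) ≤ M.eRk ((gr M \ G : Finset α) : Set α)) :
    ∃ W : Finset α, W ⊆ gr M \ G ∧ M.Indep (W : Set α) ∧ W.card = 6 := by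
  classical
  have hsub : ((gr M \ G : Finset α) : Set α) ⊆ M.E := by
    rw [← coe_gr M]; exact_mod_cast (Finset.sdiff_subset : gr M \ G ⊆ gr M)
  obtain ⟨I, hI⟩ := M.exists_isBasis ((gr M \ G : Finset α) : Set α) hsub
  have hIfin : I.Finite := (gr M \ G).finite_toSet.subset hI.subset
  have hIcard : 6 ≤ hIfin.toFinset.card := by
    have h := hI.encard_eq_eRk
    have h' : I.encard = (hIfin.toFinset.card : ℕ∞) := Set.Finite.encard_eq_coe_toFinset_card hIfin
    have : (6 : ℕ∞) ≤ (hIfin.toFinset.card : ℕ∞) := by rw [← h', h]; exact hr6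
    exact_mod_cast this
  obtain ⟨W, hWI, hW6⟩ := Finset.exists_subset_card_eq hIcard
  refine ⟨W, ?_, ?_, hW6⟩
  · intro y hy
    have := hWI hy
    rw [Set.Finite.mem_toFinset] at this
    exact_mod_cast hI.subset this
  · apply hI.indep.subset
    intro y hy
    have : y ∈ hIfin.toFinset := hWI (by exact_mod_cast hy)
    rwa [Set.Finite.mem_toFinset] at this

/-- **The per-plane inequality for the coindependent planes (`ρ(E ∖ G) ≥ 6`), modulo Theorem P₁.**  Let `M` be simple,
`G` a plane with `ρ(E ∖ G) ≥ 6`, and assume the per-triple lemma in mine-2's primal form (`hP₁`): for every triple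
`T ∈ U_G` and every independent `6`-set `W ⊆ E ∖ G`, the witnesses `S` with `S ∩ G = T` and `S ∖ G ⊆ W` already supply
`≥ 3`.  Then `3 · #U_G ≤ Σ_{S ∈ Y(6,3)} f(G, S) / Σ_{G'} f(G', S)`. -/
theorem perPlane_of_six_le (hs : Simple M) {G : Finset α} (hG : G ∈ planes M)
    (hr6 : (6 : ℕ∞) ≤ M.eRk ((gr M \ G : Finset α) : Set α))
    (hP₁ : ∀ T ∈ UqG M 6 3 G, T.card = 3 → ∀ W ⊆ gr M \ G, M.Indep (W : Set α) → W.card = 6 →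
      (3 : ℚ) ≤ ∑ S ∈ (Yq M 6 3).filter (fun S => S ∩ G = T ∧ S \ G ⊆ W), fRule M G S / D M S) :
    (3 : ℚ) * ((UqG M 6 3 G).card : ℚ) ≤
      ∑ S ∈ Yq M 6 3, fRule M G S / ∑ G' ∈ planes M, fRule M G' S := by
  classical
  obtain ⟨W, hWsub, hWind, hW6⟩ := exists_indep_six hr6
  have hWg : W ⊆ gr M := hWsub.trans Finset.sdiff_subset
  have hWG : Disjoint W G := Finset.disjoint_of_subset_left hWsub Finset.sdiff_disjoint
  have hY : ∀ S, S ⊆ gr M → (3 : ℕ∞) < M.eRk (S : Set α) → M.eRk (S : Set α) < 6 → S ∈ Yq M 6 3 :=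
    fun S h1 h2 h3 => mem_Yq_six_three.2 ⟨h1, h2, h3⟩
  calc (3 : ℚ) * ((UqG M 6 3 G).card : ℚ) = ∑ _B ∈ UqG M 6 3 G, (3 : ℚ) := by
        rw [Finset.sum_const, nsmul_eq_mul, mul_comm]
    _ ≤ ∑ B ∈ UqG M 6 3 G, ∑ S ∈ (Yq M 6 3).filter (fun S => S ∩ G = B), fRule M G S / D M S := by
        apply Finset.sum_le_sum
        intro B hB
        obtain ⟨⟨hBg, hrB, -⟩, hBG⟩ := mem_UqG_six_three.1 hB
        have hb3 : 3 ≤ B.card := three_le_card_of_eRk_eq_three hrB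
        rcases Nat.eq_or_lt_of_le hb3 with h3 | h4
        · -- a triple: restrict the witnesses to `W`, then P₁
          calc (3 : ℚ) ≤ ∑ S ∈ (Yq M 6 3).filter (fun S => S ∩ G = B ∧ S \ G ⊆ W), fRule M G S / D M S :=
                hP₁ B hB h3.symm W hWsub hWind hW6
            _ ≤ _ := by
                apply Finset.sum_le_sum_of_subset_of_nonneg
                · intro S hS
                  rw [Finset.mem_filter] at hS ⊢
                  exact ⟨hS.1, hS.2.1⟩
                · intro S _ _
                  exact div_nonneg (fRule_nonneg M G S) (D_nonneg M S)
        · exact supply_ge_three_of_four_le hs hG hBG hrB h4 hWg hWG hW6 (Yq M 6 3) hY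
    _ ≤ ∑ S ∈ Yq M 6 3, fRule M G S / D M S := sum_UqG_le_supply G
    _ = ∑ S ∈ Yq M 6 3, fRule M G S / ∑ G' ∈ planes M, fRule M G' S := rfl

end SixThree

end PercRepro
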